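import Literature.Barriers.CriticalPhenomena.TimarOnePartition
import Literature.Barriers.CriticalPhenomena.TimarEdgeRatioQuasiTransitive
import HarnessLib

/-!
# Timár 2006, §5 on QUASI-TRANSITIVE graphs: the 1-partition (random invariant partition of the
# levels into slabs of width `μ = δ⁻¹`) — PROVED

Barrier catalogue `Literature/Barriers/CriticalPhenomena/`; the quasi-transitive twin of
`TimarOnePartition.lean` (TRANSITIVE graphs, `μ = Δ⁻¹` with `Δ = minNbrWeight G o`). On a
quasi-transitive graph Timár's "`μ` := the maximum of `w(x)/w(y)`, where `x` and `y` are adjacent"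
is `δ⁻¹` for the extreme edge ratio `δ = minEdgeRatio G` of `TimarEdgeRatioQuasiTransitive.lean`
(`0 < δ < 1` on a connected, locally finite, quasi-transitive, nonunimodular graph), and the whole
construction of the tree file goes through VERBATIM with `δ` for `Δ`: the random parameter
`θ ∈ ℝ/ℤ` and its representative `U = unitLift θ` (reused), the class index
`oneIndexQ G o θ x = ⌈log_μ w(x) - U⌉`, the 1-partition `OnePartitionRelQ`, its classes the slabs
`weightSlab G o (δ b) b` (`setOf_onePartitionRelQ_eq_weightSlab`), the action
`onePartitionActQ G o γ θ = θ + log_μ w(γ o)` and invariance (`onePartitionRelQ_act_iff`),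
measurability, and the package `Timar2006_onePartition_quasiTransitive`. Á. Timár, *Percolation on
nonunimodular transitive graphs*, Ann. Probab. 34 (2006) 2344–2364, §5 (first paragraph; "each
class in the 1-partition is a slab").

## References

* Á. Timár, Ann. Probab. 34 (2006) 2344–2364 (arXiv:math/0702875v1), §5: first paragraph
  (`μ`, the 1-partition, its invariance), slabs, the paragraph before Prop. 5.4. [Timar2006]
* R. Lyons, Y. Peres, O. Schramm, Ann. Probab. 34 (2006) 1665–1692 (origin of the tilted random
  partition). [LyonsPeresSchramm2006]
* T. Hutchcroft, C. R. Math. Acad. Sci. Paris 354 (2016) 944–947, §2 (quasi-transitive setting).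
  [Hutchcroft2016]
-/

noncomputable section

namespace Literature.Barriers.CriticalPhenomena

open _root_.MeasureTheory _root_.Filter _root_.Topology
open Literature.Probability.LatticeModels Literature.Probability.Percolation

open scoped _root_.ENNReal

variable {V : Type*}

/-! ### Timár's `μ` and the base-`μ` heights (quasi-transitive) -/

/-- **Timár's `μ`** on a quasi-transitive graph: "the maximum of `w(x)/w(y)`, where `x` and `y` are
adjacent vertices in `G`", i.e. `δ⁻¹` for the extreme edge ratio `δ = minEdgeRatio G`, as a real
number. [cite: Timar2006, §5 (first paragraph: μ)] -/
def timarMuQ (G : SimpleGraph V) [G.LocallyFinite] : ℝ := ((minEdgeRatio G)⁻¹).toReal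

/-- `μ > 1` on a connected, locally finite, quasi-transitive nonunimodular graph (`δ < 1`).
[cite: Timar2006, §5 (first paragraph)] -/
theorem one_lt_timarMuQ {G : SimpleGraph V} [G.LocallyFinite] (hconn : G.Connected)
    (hqt : IsQuasiTransitive G) (hU : ¬ IsGraphUnimodular G) : 1 < timarMuQ G := by
  rw [timarMuQ]
  have h1 : minEdgeRatio G < 1 := minEdgeRatio_lt_one hconn hU
  have h0 : minEdgeRatio G ≠ 0 := minEdgeRatio_ne_zero hconn hqt
  have hinv : 1 < (minEdgeRatio G)⁻¹ := ENNReal.one_lt_inv.2 h1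
  have hinvT : (minEdgeRatio G)⁻¹ ≠ ⊤ := ENNReal.inv_ne_top.2 h0
  have := (ENNReal.toReal_lt_toReal ENNReal.one_ne_top hinvT).2 hinv
  simpa using this

/-- `μ > 0`. [folklore] -/
theorem timarMuQ_pos {G : SimpleGraph V} [G.LocallyFinite] (hconn : G.Connected)
    (hqt : IsQuasiTransitive G) (hU : ¬ IsGraphUnimodular G) : 0 < timarMuQ G :=
  one_pos.trans (one_lt_timarMuQ hconn hqt hU)

/-- `log μ > 0`. [folklore] -/
theorem log_timarMuQ_pos {G : SimpleGraph V} [G.LocallyFinite] (hconn : G.Connected)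
    (hqt : IsQuasiTransitive G) (hU : ¬ IsGraphUnimodular G) : 0 < Real.log (timarMuQ G) :=
  Real.log_pos (one_lt_timarMuQ hconn hqt hU)

/-- `μ⁻¹ = Δ` (as real numbers). [folklore] -/
theorem inv_timarMuQ {G : SimpleGraph V} [G.LocallyFinite] :
    (timarMuQ G)⁻¹ = (minEdgeRatio G).toReal := by
  rw [timarMuQ, ENNReal.toReal_inv, inv_inv]

/-- The **base-`μ` height** `log_μ w_o(x)` of a vertex: the natural-log height `levelHeight`
of `TimarLevelExhaustion.lean` rescaled by `log μ`. [cite: Timar2006, §5 (log_μ w(x))] -/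
def logHeightQ (G : SimpleGraph V) [G.LocallyFinite] (o x : V) : ℝ :=
  levelHeight G o x / Real.log (timarMuQ G)

/-- Unfolding down to the weights. [folklore] -/
theorem logHeightQ_eq (G : SimpleGraph V) [G.LocallyFinite] (o x : V) :
    logHeightQ G o x = Real.log (autWeight G o x).toReal / Real.log (timarMuQ G) := rfl

/-- The base vertex has height `0`. [folklore] -/
theorem logHeightQ_self {G : SimpleGraph V} [G.LocallyFinite] (hconn : G.Connected) (o : V) :
    logHeightQ G o o = 0 := by
  rw [logHeightQ, levelHeight_self G hconn o, zero_div]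

/-- `w(x) = μ ^ (log_μ w(x))`. [folklore] -/
theorem toReal_autWeight_eq_rpowQ {G : SimpleGraph V} [G.LocallyFinite] (hconn : G.Connected)
    (hqt : IsQuasiTransitive G) (hU : ¬ IsGraphUnimodular G) (o x : V) :
    (autWeight G o x).toReal = timarMuQ G ^ logHeightQ G o x := by
  rw [Real.rpow_def_of_pos (timarMuQ_pos hconn hqt hU), logHeightQ_eq,
    mul_div_cancel₀ _ (log_timarMuQ_pos hconn hqt hU).ne', Real.exp_log (toReal_autWeight_pos G hconn o x)]

/-- **Same level iff same base-`μ` height** ("two vertices are on the same level if and only if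
their weights are the same"). [cite: Timar2006, §2 and §5 ("the 1-partition of G also partitions its levels")] -/
theorem sameLevel_iff_logHeightQ_eq {G : SimpleGraph V} [G.LocallyFinite] (hconn : G.Connected)
    (hqt : IsQuasiTransitive G) (hU : ¬ IsGraphUnimodular G) (o x y : V) :
    SameLevel G x y ↔ logHeightQ G o x = logHeightQ G o y := by
  rw [sameLevel_iff_autWeight_eq G hconn o]
  constructor
  · intro h; rw [logHeightQ_eq, logHeightQ_eq, h]
  · intro h
    have h' : (autWeight G o x).toReal = (autWeight G o y).toReal := by
      rw [toReal_autWeight_eq_rpowQ hconn hqt hU o x, toReal_autWeight_eq_rpowQ hconn hqt hU o y, h]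
    exact (ENNReal.toReal_eq_toReal_iff' (autWeight_ne_top G hconn o x) (autWeight_ne_top G hconn o y)).1 h'

/-- **Automorphisms shift all base-`μ` heights by one constant**: `log_μ w(γ v) = log_μ w(v) + log_μ w(γ o)`
("any automorphism of `G` acts on the weights of the levels by multiplying them with a
constant"). [cite: Timar2006, §5 (paragraph before Prop. 5.4)] -/
theorem logHeightQ_map {G : SimpleGraph V} [G.LocallyFinite] (hconn : G.Connected) (γ : G ≃g G)
    (o v : V) : logHeightQ G o (γ v) = logHeightQ G o v + logHeightQ G o (γ o) := by
  rw [logHeightQ, logHeightQ, logHeightQ, levelHeight_map G hconn γ o v, add_div]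

/-! ### The 1-partition -/

section OnePartition

variable (G : SimpleGraph V) [G.LocallyFinite] (o : V)

/-- The **class index** of a vertex in the 1-partition with parameter `θ`: `⌈log_μ w(x) - U⌉`
(the printed classes `[n + U, n + 1 + U)` of `log_μ w`, here `(n - 1 + U, n + U]` so that classes
are the tree's slabs `(a, b]`; see the module docstring). [cite: Timar2006, §5 (the 1-partition)] -/
def oneIndexQ (θ : UnitAddCircle) (x : V) : ℤ := ⌈logHeightQ G o x - unitLift θ⌉

/-- **The 1-partition** with parameter `θ`: `x` and `y` are in the same class iff `log_μ w(x)` and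
`log_μ w(y)` lie in the same unit interval of the grid shifted by `U`.
[cite: Timar2006, §5 (the 1-partition)] -/
def OnePartitionRelQ (θ : UnitAddCircle) (x y : V) : Prop := oneIndexQ G o θ x = oneIndexQ G o θ y

/-- The 1-partition is a partition (the kernel of the class index). [cite: Timar2006, §5 (the 1-partition)] -/
theorem onePartitionRelQ_equivalence (θ : UnitAddCircle) : Equivalence (OnePartitionRelQ G o θ) :=
  ⟨fun _ => rfl, fun h => h.symm, fun h₁ h₂ => h₁.trans h₂⟩

/-- Unfolding. [folklore] -/
theorem onePartitionRelQ_iff {θ : UnitAddCircle} {x y : V} :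
    OnePartitionRelQ G o θ x y ↔ oneIndexQ G o θ x = oneIndexQ G o θ y := Iff.rfl

variable {G o}

/-- **"The 1-partition of `G` also partitions its levels"**: the class index only depends on the
level. [cite: Timar2006, §5 (first paragraph)] -/
theorem oneIndexQ_eq_of_sameLevel (hconn : G.Connected) (hqt : IsQuasiTransitive G)
    (hU : ¬ IsGraphUnimodular G) (θ : UnitAddCircle) {x y : V} (h : SameLevel G x y) :
    oneIndexQ G o θ x = oneIndexQ G o θ y := by
  rw [oneIndexQ, oneIndexQ, (sameLevel_iff_logHeightQ_eq hconn hqt hU o x y).1 h]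

/-- Vertices on a common level are in a common class. [cite: Timar2006, §5 (first paragraph)] -/
theorem onePartitionRelQ_of_sameLevel (hconn : G.Connected) (hqt : IsQuasiTransitive G)
    (hU : ¬ IsGraphUnimodular G) (θ : UnitAddCircle) {x y : V} (h : SameLevel G x y) :
    OnePartitionRelQ G o θ x y :=
  oneIndexQ_eq_of_sameLevel hconn hqt hU θ h

/-- The classes are saturated with respect to the levels. [cite: Timar2006, §5 (first paragraph)] -/
theorem onePartitionRelQ_of_sameLevel_left (hconn : G.Connected) (hqt : IsQuasiTransitive G)
    (hU : ¬ IsGraphUnimodular G) {θ : UnitAddCircle} {x x' y : V} (hx : SameLevel G x x')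
    (h : OnePartitionRelQ G o θ x y) : OnePartitionRelQ G o θ x' y :=
  (oneIndexQ_eq_of_sameLevel hconn hqt hU θ hx).symm.trans h

/-! #### Each class is a slab -/

/-- `log_μ w(y) ≤ c ↔ w(y) ≤ μ^c`. [folklore] -/
theorem logHeightQ_le_iff (hconn : G.Connected) (hqt : IsQuasiTransitive G) (hU : ¬ IsGraphUnimodular G)
    (y : V) (c : ℝ) : logHeightQ G o y ≤ c ↔ (autWeight G o y).toReal ≤ timarMuQ G ^ c := by
  rw [toReal_autWeight_eq_rpowQ hconn hqt hU o y,
    Real.rpow_le_rpow_left_iff (one_lt_timarMuQ hconn hqt hU)]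

/-- `c < log_μ w(y) ↔ μ^c < w(y)`. [folklore] -/
theorem lt_logHeightQ_iff (hconn : G.Connected) (hqt : IsQuasiTransitive G) (hU : ¬ IsGraphUnimodular G)
    (y : V) (c : ℝ) : c < logHeightQ G o y ↔ timarMuQ G ^ c < (autWeight G o y).toReal := by
  rw [toReal_autWeight_eq_rpowQ hconn hqt hU o y,
    Real.rpow_lt_rpow_left_iff (one_lt_timarMuQ hconn hqt hU)]

/-- The upper end `b = μ^{n + U}` of the class with index `n`, as an extended nonnegative real.
[cite: Timar2006, §5 ("each class in the 1-partition is a slab")] -/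
def oneClassTopQ (G : SimpleGraph V) [G.LocallyFinite] (θ : UnitAddCircle) (n : ℤ) : ℝ≥0∞ :=
  ENNReal.ofReal (timarMuQ G ^ ((n : ℝ) + unitLift θ))

/-- `b ≠ 0`. [folklore] -/
theorem oneClassTopQ_ne_zero (hconn : G.Connected) (hqt : IsQuasiTransitive G)
    (hU : ¬ IsGraphUnimodular G) (θ : UnitAddCircle) (n : ℤ) : oneClassTopQ G θ n ≠ 0 := by
  rw [oneClassTopQ, ne_eq, ENNReal.ofReal_eq_zero, not_le]
  exact Real.rpow_pos_of_pos (timarMuQ_pos hconn hqt hU) _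

/-- `b ≠ ⊤`. [folklore] -/
theorem oneClassTopQ_ne_top (θ : UnitAddCircle) (n : ℤ) : oneClassTopQ G θ n ≠ ⊤ :=
  ENNReal.ofReal_ne_top

/-- The lower end of the class with index `n` is `Δ b`: `μ^{n - 1 + U} = Δ μ^{n + U}`. [folklore] -/
theorem ofReal_rpow_sub_oneQ (hconn : G.Connected) (hqt : IsQuasiTransitive G)
    (hU : ¬ IsGraphUnimodular G) (θ : UnitAddCircle) (n : ℤ) :
    ENNReal.ofReal (timarMuQ G ^ ((n : ℝ) - 1 + unitLift θ)) =
      minEdgeRatio G * oneClassTopQ G θ n := by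
  have hμ := timarMuQ_pos hconn hqt hU
  have h : timarMuQ G ^ ((n : ℝ) - 1 + unitLift θ) =
      (minEdgeRatio G).toReal * timarMuQ G ^ ((n : ℝ) + unitLift θ) := by
    rw [show (n : ℝ) - 1 + unitLift θ = ((n : ℝ) + unitLift θ) + (-1) by ring,
      Real.rpow_add hμ, Real.rpow_neg_one, inv_timarMuQ, mul_comm]
  rw [h, ENNReal.ofReal_mul ENNReal.toReal_nonneg, oneClassTopQ,
    ENNReal.ofReal_toReal (minEdgeRatio_ne_top hconn hU)]

/-- **"Each class in the 1-partition is a slab"**: the class of `x` (index `n = ⌈log_μ w(x) - U⌉`)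
is the slab `{v : Δ b < w(v) ≤ b}` with `b = μ^{n + U}` — a slab of `TimarSlabs.lean` with the
width hypothesis `a ≤ Δ b` satisfied with equality.
[cite: Timar2006, §5 ("Note that each class in the 1-partition is a slab")] -/
theorem setOf_onePartitionRelQ_eq_weightSlab (hconn : G.Connected) (hqt : IsQuasiTransitive G)
    (hU : ¬ IsGraphUnimodular G) (θ : UnitAddCircle) (x : V) :
    {y | OnePartitionRelQ G o θ x y} =
      weightSlab G o (minEdgeRatio G * oneClassTopQ G θ (oneIndexQ G o θ x))
        (oneClassTopQ G θ (oneIndexQ G o θ x)) := by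
  ext y
  set n : ℤ := oneIndexQ G o θ x with hn
  rw [Set.mem_setOf_eq, mem_weightSlab, onePartitionRelQ_iff, ← hn, eq_comm, oneIndexQ, Int.ceil_eq_iff,
    ← ofReal_rpow_sub_oneQ hconn hqt hU θ n, oneClassTopQ]
  have hyT := autWeight_ne_top G hconn o y
  have h1 : (↑n - 1 < logHeightQ G o y - unitLift θ) ↔
      ENNReal.ofReal (timarMuQ G ^ ((n : ℝ) - 1 + unitLift θ)) < autWeight G o y := by
    rw [show (↑n - 1 < logHeightQ G o y - unitLift θ) ↔ ((n : ℝ) - 1 + unitLift θ < logHeightQ G o y) by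
        constructor <;> intro h <;> linarith,
      lt_logHeightQ_iff hconn hqt hU y, ENNReal.ofReal_lt_iff_lt_toReal (Real.rpow_nonneg
        (timarMuQ_pos hconn hqt hU).le _) hyT]
  have h2 : (logHeightQ G o y - unitLift θ ≤ ↑n) ↔
      autWeight G o y ≤ ENNReal.ofReal (timarMuQ G ^ ((n : ℝ) + unitLift θ)) := by
    rw [show (logHeightQ G o y - unitLift θ ≤ ↑n) ↔ (logHeightQ G o y ≤ (n : ℝ) + unitLift θ) by
        constructor <;> intro h <;> linarith,
      logHeightQ_le_iff hconn hqt hU y, ← ENNReal.ofReal_toReal hyT,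
      ENNReal.ofReal_le_ofReal_iff (Real.rpow_nonneg (timarMuQ_pos hconn hqt hU).le _),
      ENNReal.ofReal_toReal hyT]
  rw [h1, h2]

/-- Hence every class of the 1-partition is a slab `weightSlab G o (Δ b) b` for some
`b ∈ (0, ∞)`. [cite: Timar2006, §5 ("each class in the 1-partition is a slab")] -/
theorem exists_setOf_onePartitionRelQ_eq_weightSlab (hconn : G.Connected) (hqt : IsQuasiTransitive G)
    (hU : ¬ IsGraphUnimodular G) (θ : UnitAddCircle) (x : V) :
    ∃ b : ℝ≥0∞, b ≠ 0 ∧ b ≠ ⊤ ∧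
      {y | OnePartitionRelQ G o θ x y} = weightSlab G o (minEdgeRatio G * b) b :=
  ⟨_, oneClassTopQ_ne_zero hconn hqt hU θ _, oneClassTopQ_ne_top θ _,
    setOf_onePartitionRelQ_eq_weightSlab hconn hqt hU θ x⟩

/-! #### The action of `Aut(G)` and invariance -/

variable (G o) in
/-- **The action of `Aut(G)` on the parameter**: the rotation of the circle by `log_μ w(γ o)`, the
constant by which `γ` shifts all base-`μ` heights. [cite: Timar2006, §5 (invariance of the 1-partition; paragraph before Prop. 5.4)] -/
def onePartitionActQ (γ : G ≃g G) (θ : UnitAddCircle) : UnitAddCircle :=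
  θ + ((logHeightQ G o (γ o) : ℝ) : UnitAddCircle)

/-- The action is compatible with composition: `(γ' ∘ γ) • θ = γ' • (γ • θ)`. [folklore] -/
theorem onePartitionActQ_trans (hconn : G.Connected) (γ γ' : G ≃g G) (θ : UnitAddCircle) :
    onePartitionActQ G o (γ.trans γ') θ = onePartitionActQ G o γ' (onePartitionActQ G o γ θ) := by
  simp only [onePartitionActQ]
  change θ + ((logHeightQ G o (γ' (γ o)) : ℝ) : UnitAddCircle) = _
  rw [logHeightQ_map hconn γ' o (γ o), AddCircle.coe_add, add_assoc]

/-- The identity acts trivially. [folklore] -/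
@[simp] theorem onePartitionActQ_refl (hconn : G.Connected) (θ : UnitAddCircle) :
    onePartitionActQ G o (RelIso.refl _) θ = θ := by
  simp only [onePartitionActQ]
  change θ + ((logHeightQ G o o : ℝ) : UnitAddCircle) = θ
  rw [logHeightQ_self hconn o, AddCircle.coe_zero, add_zero]

/-- The action is measurable … [folklore] -/
theorem measurable_onePartitionActQ (γ : G ≃g G) : Measurable (onePartitionActQ G o γ) :=
  measurable_add_const _

/-- … and preserves the Haar probability measure of the circle ("Choose `U ∈ [0, 1]` uniformly at
random": the law of the parameter is invariant under the action). [cite: Timar2006, §5 (invariance of the 1-partition)] -/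
theorem measurePreserving_onePartitionActQ (γ : G ≃g G) :
    MeasurePreserving (onePartitionActQ G o γ) (volume : Measure UnitAddCircle) volume :=
  measurePreserving_add_right volume _

/-- **All class indices shift by the same integer** when `γ` is applied to the vertices and the
parameter is rotated accordingly: `n(γ • θ, γ x) = n(θ, x) + ⌊U + log_μ w(γ o)⌋`.
[cite: Timar2006, §5 (invariance of the 1-partition)] -/
theorem oneIndexQ_act (hconn : G.Connected) (γ : G ≃g G) (θ : UnitAddCircle) (x : V) :
    oneIndexQ G o (onePartitionActQ G o γ θ) (γ x) =
      oneIndexQ G o θ x + ⌊unitLift θ + logHeightQ G o (γ o)⌋ := by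
  rw [oneIndexQ, oneIndexQ, onePartitionActQ, unitLift_add_coe, logHeightQ_map hconn γ o x]
  have h : logHeightQ G o x + logHeightQ G o (γ o) -
      (unitLift θ + logHeightQ G o (γ o) - (⌊unitLift θ + logHeightQ G o (γ o)⌋ : ℝ)) =
      logHeightQ G o x - unitLift θ + ((⌊unitLift θ + logHeightQ G o (γ o)⌋ : ℤ) : ℝ) := by ring
  rw [h, Int.ceil_add_intCast]

/-- **The 1-partition is `Aut(G)`-invariant**: `γ x` and `γ y` are in a common class for the
rotated parameter iff `x` and `y` are for the original one ("here, we shall get a partition that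
is automorphism-invariant"). [cite: Timar2006, §5 (invariance of the 1-partition)] -/
theorem onePartitionRelQ_act_iff (hconn : G.Connected) (γ : G ≃g G) (θ : UnitAddCircle) (x y : V) :
    OnePartitionRelQ G o (onePartitionActQ G o γ θ) (γ x) (γ y) ↔ OnePartitionRelQ G o θ x y := by
  rw [onePartitionRelQ_iff, onePartitionRelQ_iff, oneIndexQ_act hconn, oneIndexQ_act hconn, add_left_inj]

/-! #### Measurability in the parameter -/

/-- The class index is a measurable function of the parameter. [folklore] -/
theorem measurable_oneIndexQ (x : V) : Measurable fun θ : UnitAddCircle => oneIndexQ G o θ x :=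
  Int.measurable_ceil.comp (measurable_const.sub measurable_unitLift)

/-- The events "`x ∼_θ y`" are measurable in the parameter. [folklore] -/
theorem measurableSet_setOf_onePartitionRelQ (x y : V) :
    MeasurableSet {θ : UnitAddCircle | OnePartitionRelQ G o θ x y} :=
  measurableSet_eq_fun (measurable_oneIndexQ x) (measurable_oneIndexQ y)

end OnePartition

/-- **Timár 2006, §5: the 1-partition, PROVED (packaged).** On a connected, locally finite,
transitive, nonunimodular graph there is a probability space (the circle with its Haar measure)
carrying an action of `Aut(G)` by measure-preserving maps and a random equivalence relation on
the vertices — the 1-partition — which is saturated with respect to the levels, whose classes are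
slabs `{v : Δ b < w(v) ≤ b}` (`0 < b < ∞`; width exactly Timár's `μ = Δ⁻¹`), and which is
invariant: `γ x ∼_{γ • θ} γ y ↔ x ∼_θ y`.
[cite: Timar2006, §5 (the 1-partition; "each class in the 1-partition is a slab")] -/
theorem Timar2006_onePartition_quasiTransitive {V : Type*} (G : SimpleGraph V) [G.LocallyFinite]
    (hconn : G.Connected) (hqt : IsQuasiTransitive G) (hU : ¬ IsGraphUnimodular G) (o : V) :
    ∃ (Ω : Type) (_ : MeasurableSpace Ω) (P : Measure Ω) (_ : IsProbabilityMeasure P)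
      (act : (G ≃g G) → Ω → Ω) (rel : Ω → V → V → Prop),
      (∀ γ γ', act (γ.trans γ') = act γ' ∘ act γ) ∧
      (∀ γ, MeasurePreserving (act γ) P P) ∧
      (∀ θ, Equivalence (rel θ)) ∧
      (∀ θ x y, SameLevel G x y → rel θ x y) ∧
      (∀ θ x, ∃ b : ℝ≥0∞, b ≠ 0 ∧ b ≠ ⊤ ∧ {y | rel θ x y} = weightSlab G o (minEdgeRatio G * b) b) ∧
      (∀ θ γ x y, rel (act γ θ) (γ x) (γ y) ↔ rel θ x y) ∧
      (∀ x y, MeasurableSet {θ | rel θ x y}) :=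
  ⟨UnitAddCircle, inferInstance, volume, inferInstance, onePartitionActQ G o, OnePartitionRelQ G o,
    fun γ γ' => funext (onePartitionActQ_trans hconn γ γ'),
    measurePreserving_onePartitionActQ,
    onePartitionRelQ_equivalence G o,
    fun θ _ _ h => onePartitionRelQ_of_sameLevel hconn hqt hU θ h,
    exists_setOf_onePartitionRelQ_eq_weightSlab hconn hqt hU,
    fun θ γ x y => onePartitionRelQ_act_iff hconn γ θ x y,
    measurableSet_setOf_onePartitionRelQ⟩

end Literature.Barriers.CriticalPhenomena

end
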